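import Literature.AnabelianGeometry.SemiGraphs.TemperoidsGaloisProofs
import Literature.AnabelianGeometry.SemiGraphs.TemperoidsGaloisTorsorProofs
import HarnessLib

/-!
# [SemiAnbd] Remarks 3.1.3 / 3.1.6: the named facts `GaloisObjIffTorsor`, `EndOfGaloisIsIso` — universal
# closures AS TYPED (no `[IsTopologicalGroup Π]`)

Mochizuki, *Semi-graphs of anabelioids*, Publ. RIMS **42** (2006) 221–322, §3, manuscript p. 34,
Remark 3.1.3 ("a connected object `T` of `T := B^temp(Π)` is Galois if and only if the product `T × T` is
isomorphic to the coproduct of copies of `T` indexed by the elements of the [countable!] set `Aut_T(T)` …")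
and Remark 3.1.6 ("every endomorphism of a Galois connected object of a temperoid is an automorphism")
[cite: MochizukiSemiAnbd2006, Rmk 3.1.3 p.34] [cite: MochizukiSemiAnbd2006, Rmk 3.1.6 p.34].

PROOF-ONLY companion (no definitions) of `Temperoids.lean` (seat abc-iut-L3-t2); cell abc-iut, block F,
seat abc-iut-f-045.  FACT-LIST rows **F-1758** `GaloisObjIffTorsor` and **F-1755** `EndOfGaloisIsIso`: both
defs are typed over `(G : Type u) [Group G] [TopologicalSpace G]` (the section's `[IsTopologicalGroup G]`
variable is not used by their bodies, hence not a binder of the defs), while the landed discharges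
`GaloisObjIffTorsor_holds` (`TemperoidsGaloisTorsorProofs.lean`) and `EndOfGaloisIsIso_holds`
(`TemperoidsGaloisProofs.lean`) carry an extra — IDLE — `[IsTopologicalGroup G]` binder, so the R7 kernel
TYPE-audit (abc-iut-w5-d199 v2) found no theorem whose type is EXACTLY the universal closure.  The
arguments are plain category theory over `B^temp(Π)` for ANY topology on the group `Π`
(`IsGaloisObj.isIso_of_endo`; the `GaloisTorsor` section of the torsor file is stated over
`[Group G] [TopologicalSpace G]` only), so the closures AS TYPED hold:
* `GaloisObjIffTorsor_closure : ∀ (G : Type u) [Group G] [TopologicalSpace G], GaloisObjIffTorsor G`;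
* `EndOfGaloisIsIso_closure   : ∀ (G : Type u) [Group G] [TopologicalSpace G], EndOfGaloisIsIso G`.
Nothing is restated; no statement of the paper is strengthened in content (the printed `Π` is a tempered
topological group — the hypothesis `IsTempered G` stays inside both defs); nothing here bears on
[IUTchIII] Cor. 3.12.  A FACT row is an assumption label, not an endorsement.
-/

open CategoryTheory CategoryTheory.Limits

namespace Literature.AnabelianGeometry.SemiGraphs

universe u

/-- **[SemiAnbd] Remark 3.1.3, second sentence — universal closure AS TYPED (F-1758).** For every group
`Π` with ANY topology (no `[IsTopologicalGroup Π]`): if `Π` is tempered and `T` is a connected object of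
`B^temp(Π)`, then `T` is Galois iff for every product cone `P` of `(T, T)` the cofan
`(𝟙, σ)_{σ ∈ Aut T} : ∐ T → P.pt` is a coproduct.  One line over abc-iut's
`GaloisTorsor.cofan_isColimit_of_isGaloisObj` / `GaloisTorsor.isGaloisObj_of_cofan_isColimit`.
[cite: MochizukiSemiAnbd2006, Rmk 3.1.3 p.34] -/
theorem GaloisObjIffTorsor_closure :
    ∀ (G : Type u) [Group G] [TopologicalSpace G],
      Literature.AnabelianGeometry.SemiGraphs.GaloisObjIffTorsor G := fun _ _ _ _ T hT =>
  ⟨fun hgal P hP => GaloisTorsor.cofan_isColimit_of_isGaloisObj T hgal P hP,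
    fun h => GaloisTorsor.isGaloisObj_of_cofan_isColimit T hT h⟩

/-- **[SemiAnbd] Remark 3.1.6 — universal closure AS TYPED (F-1755).** For every group `Π` with ANY
topology: every endomorphism of a Galois object of `B^temp(Π)` is an isomorphism (the Galois property
applied to `𝟙` and `f`, `IsGaloisObj.isIso_of_endo`). [cite: MochizukiSemiAnbd2006, Rmk 3.1.6 p.34] -/
theorem EndOfGaloisIsIso_closure :
    ∀ (G : Type u) [Group G] [TopologicalSpace G],
      Literature.AnabelianGeometry.SemiGraphs.EndOfGaloisIsIso G := fun _ _ _ _ _ hT f =>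
  hT.isIso_of_endo f

/-- The landed discharge `GaloisObjIffTorsor_holds` is the closure specialised to topological groups
(its `[IsTopologicalGroup G]` binder is idle). [cite: MochizukiSemiAnbd2006, Rmk 3.1.3 p.34] -/
example (G : Type u) [Group G] [TopologicalSpace G] [IsTopologicalGroup G] :
    GaloisObjIffTorsor_holds G = GaloisObjIffTorsor_closure G := rfl

/-- The landed discharge `EndOfGaloisIsIso_holds` is the closure specialised to topological groups.
[cite: MochizukiSemiAnbd2006, Rmk 3.1.6 p.34] -/
example (G : Type u) [Group G] [TopologicalSpace G] [IsTopologicalGroup G] :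
    EndOfGaloisIsIso_holds G = EndOfGaloisIsIso_closure G := rfl

end Literature.AnabelianGeometry.SemiGraphs
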